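import Literature.AlgebraicGeometry.Hyperkaehler.LefschetzClassesBeauvilleForm
import Literature.AlgebraicGeometry.HodgeTheory.ComplexGysinRational
import HarnessLib

/-!
# Classes of Lefschetz type on a projective irreducible symplectic variety from `a^{2n} ≠ 0`:
# binder `#7` of the `Kum⁴` Hodge blueprint from the Looijenga–Lunts and Beauville–Fujiki records

Layer `Literature/AlgebraicGeometry/Hyperkaehler`; companion of `LefschetzClassesBeauvilleForm.lean`
(K5 harvest, H1 glue G7).  That file records the two printed inputs of Verbitsky's theorem
"`a ∈ H²(X)` with `a^{2n} ≠ 0` is of Lefschetz type" in Beauville-form language — S7a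
`LooijengaLunts1997_hasDualLefschetz_of_beauvilleForm_ne_zero` (`q(a) ≠ 0 ⇒` dual Lefschetz, LL (1.9),
(1.13), (4.5)) and S7b `BeauvilleFujiki_kronecker_cupPowTwo_eq` (`⟨a^{2n}, [X]_μ⟩ = c · q(a)ⁿ`, `c > 0`) —
and PROVES the kernel step `⟨a^{2n}, [X]_μ⟩ ≠ 0 ⇒` dual Lefschetz
(`hasDualLefschetz_of_kronecker_cupPowTwo_ne_zero`).  Two steps were left between that and binder `#7`
`Verbitsky1996_hasDualLefschetz_of_topPower_ne_zero` (`a^{2n} ≠ 0 ⇒` dual Lefschetz):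

* **R7a (PROVED here)** `kroneckerPairing_fundamentalClass_ne_zero_of_ne_zero`: on a smooth projective
  `X` of dimension `m ≥ 1`, a NON-ZERO class of top degree `x ∈ H^{2m}(X(ℂ); ℂ)` pairs non-trivially
  with the fundamental class of ANY `ℂ`-orientation: `⟨x, [X(ℂ)]_μ⟩ ≠ 0`.  Proof: the Kronecker map
  `H^{2m}(X(ℂ); ℂ) → Hom(H_{2m}, ℂ)` is injective over a field (Hatcher Thm. 3.2, p. 198; tree
  `kroneckerPairing_injective_of_field`), so `x` pairs non-trivially with some `z ∈ H_{2m}`; `X(ℂ)` is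
  a closed connected topological `2m`-manifold (GAGA; SGA1 XII 2.4 for connectedness, tree
  `HodgeTheory.connectedSpace_complexPoints`), so `z = c · [X(ℂ)]_μ` (Hatcher Thm. 3.26(a), tree
  `HodgeTheory.exists_eq_smul_fundamentalClass_of_connectedSpace`).
* **R7b (hypothesis)** the existence, for SOME orientation family `μ`, of a Beauville-normalised
  non-zero class `σ` of Hodge type `(2, 0)`, `⟨σⁿ ⌣ σ̄ⁿ, [X]_μ⟩ = 1` (Beauville 1983 §8: for the
  complex orientation `∫_X (σσ̄)ⁿ > 0`, so `σ` can be rescaled; GHJ Part III §23.2).  No record of the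
  tree produces a normalised class (`IsBeauvilleNormalised` has no producer; searched
  `rg IsBeauvilleNormalised Literature`), and this file introduces no named fact (D-0026): R7b is the
  explicit hypothesis `hσ` of the final theorem, in its printed form.

* **`verbitsky1996_hasDualLefschetz_of_topPower_ne_zero_of_pieces`** — binder `#7` follows from S7a,
  S7b and R7b (R7a being proved): kernel glue, no choices.

Everything here is a theorem; no definition, named fact, instance or notation is introduced; nothing
here asserts HC / HC_Kum4Type.  The orientation family `μ` is a parameter throughout (as in
`HodgeTheory.ComplexGysin`).

References: E. Looijenga, V. Lunts, Invent. Math. 129 (1997) (1.9), (1.13), Prop. 4.5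
[`LooijengaLunts1997`]; M. Verbitsky, GAFA 6 (1996) [`Verbitsky1996CohomologyGAFA`]; A. Beauville,
J. Diff. Geom. 18 (1983) §8 [`Beauville1983`]; M. Gross, D. Huybrechts, D. Joyce, *Calabi–Yau manifolds
and related geometries* (2003) Part III Prop. 23.14, §24 [`GrossHuybrechtsJoyce2003`]; A. Hatcher,
*Algebraic Topology* (2002) §3.1 Thm. 3.2, §3.3 Thm. 3.26 [`HatcherAT2002`].
-/

noncomputable section

open CategoryTheory Function
open Literature.AlgebraicTopology.SingularHomology
open Literature.AlgebraicGeometry.HodgeTheory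

namespace Literature.AlgebraicGeometry.Hyperkaehler

/-! ### R7a: a non-zero top-degree class integrates non-trivially -/

/-- **`x ≠ 0` in `H^{2m}(X(ℂ); ℂ)` ⇒ `⟨x, [X(ℂ)]_μ⟩ ≠ 0`** for `X` smooth projective of dimension
`m ≥ 1` and any `ℂ`-orientation family `μ`: the Kronecker map is injective over a field (Hatcher
Thm. 3.2, p. 198) and `H_{2m}(X(ℂ); ℂ) = ℂ · [X(ℂ)]_μ`, `X(ℂ)` being a closed connected `2m`-manifold
(Hatcher Thm. 3.26(a)). [cite: HatcherAT2002, §3.1 Thm. 3.2 (p. 198) and §3.3 Thm. 3.26(a)]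
[cite: SGA1, Exp. XII Prop. 2.4 (connectedness of X(ℂ))] -/
theorem kroneckerPairing_fundamentalClass_ne_zero_of_ne_zero {m : ℕ} (μ : OrientationFamily)
    {X : Motives.SchemeOver ℂ} (hX : Motives.IsSmoothProjective m X) {x : complexBetti X (2 * m)}
    (hx : x ≠ 0) :
    kroneckerPairing ℂ ℂ (Motives.ComplexPoints X) (2 * m) x (μ hX).fundamentalClass ≠ 0 := by
  letI := hX.chartedSpace
  haveI := Motives.ComplexPoints.compactSpace_of_isSmoothProjective hX
  haveI := Motives.ComplexPoints.t2Space_of_isSmoothProjective hX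
  haveI := connectedSpace_complexPoints hX
  -- `x` pairs non-trivially with some homology class `z`
  have hφ : kroneckerPairing ℂ ℂ (Motives.ComplexPoints X) (2 * m) x ≠ 0 := fun h0 ↦
    hx (kroneckerPairing_injective_of_field ℂ (Motives.ComplexPoints X) (2 * m) (by rw [h0, map_zero]))
  obtain ⟨z, hz⟩ : ∃ z, kroneckerPairing ℂ ℂ (Motives.ComplexPoints X) (2 * m) x z ≠ 0 := by
    by_contra h
    push Not at h
    exact hφ (LinearMap.ext fun z ↦ (h z).trans (LinearMap.zero_apply z).symm)
  -- … and `z` is a multiple of the fundamental class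
  obtain ⟨c, rfl⟩ := exists_eq_smul_fundamentalClass_of_connectedSpace (μ hX) z
  rw [map_smul, smul_eq_mul] at hz
  exact fun h0 ↦ hz (by rw [h0, mul_zero])

/-- The same for the top power `a^{2n}` of a degree-`2` class on a projective irreducible symplectic
`X` of dimension `2n`: `a^{2n} ≠ 0 ⇒ ⟨a^{2n}, [X]_μ⟩ ≠ 0`. [cite: HatcherAT2002, §3.1 Thm. 3.2 (p. 198) and §3.3 Thm. 3.26(a)] -/
theorem kroneckerPairing_cupPowTwo_fundamentalClass_ne_zero {n : ℕ} (μ : OrientationFamily)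
    {X : Motives.SchemeOver ℂ} (hX : IsProjectiveIrreducibleSymplectic (2 * n) X) {a : complexBetti X 2}
    (ha : cupPowTwo a (2 * n) ≠ 0) :
    kroneckerPairing ℂ ℂ (Motives.ComplexPoints X) (2 * (2 * n)) (cupPowTwo a (2 * n))
      (μ hX.1).fundamentalClass ≠ 0 :=
  kroneckerPairing_fundamentalClass_ne_zero_of_ne_zero μ hX.1 ha

/-! ### Binder #7 from the pieces -/

/-- **Verbitsky's theorem (binder #7) from the Looijenga–Lunts and Beauville–Fujiki records.**  Granted
S7a (`q(a) ≠ 0 ⇒` dual Lefschetz), S7b (`⟨a^{2n}, [X]_μ⟩ = c · q(a)ⁿ`, `c > 0`) and, for every projective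
irreducible symplectic `X` of dimension `2n`, the existence for SOME `ℂ`-orientation family `μ` of a
Beauville-normalised non-zero class `σ` of Hodge type `(2, 0)` (`⟨σⁿ ⌣ σ̄ⁿ, [X]_μ⟩ = 1`, Beauville's
normalisation `∫ (σσ̄)ⁿ = 1`), every `a ∈ H²(X(ℂ); ℂ)` with `a^{2n} ≠ 0` has the dual Lefschetz property:
`a^{2n} ≠ 0 ⇒ ⟨a^{2n}, [X]_μ⟩ ≠ 0` (R7a, `kroneckerPairing_cupPowTwo_fundamentalClass_ne_zero`)
`⇒ q(a) ≠ 0` (S7b) `⇒` dual Lefschetz (S7a).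
[cite: Verbitsky1996CohomologyGAFA, Thm. (structure Lie algebra of H*(M) ≅ 𝔰𝔬(4, b₂−2))]
[cite: LooijengaLunts1997, (1.9), (1.13) and Prop. 4.5] [cite: Beauville1983, §8 p. 772 (normalisation ∫(σσ̄)ⁿ = 1)]
[cite: GrossHuybrechtsJoyce2003, Part III Prop. 23.14 p. 182 and Prop. 24.6 p. 193] -/
theorem verbitsky1996_hasDualLefschetz_of_topPower_ne_zero_of_pieces
    (h₁ : LooijengaLunts1997_hasDualLefschetz_of_beauvilleForm_ne_zero)
    (h₂ : BeauvilleFujiki_kronecker_cupPowTwo_eq)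
    (hσ : ∀ (n : ℕ), 1 ≤ n → ∀ ⦃X : Motives.SchemeOver ℂ⦄ (hX : IsProjectiveIrreducibleSymplectic (2 * n) X),
      ∃ (μ : OrientationFamily) (σ : complexBetti X 2), IsOfHodgeType (2 * n) X 2 2 0 σ ∧ σ ≠ 0 ∧
        IsBeauvilleNormalised (μ hX.1) σ n (by omega)) :
    Verbitsky1996_hasDualLefschetz_of_topPower_ne_zero := by
  intro n hn X hX a ha
  obtain ⟨μ, σ, hσt, hσ0, hnorm⟩ := hσ n hn hX
  exact hasDualLefschetz_of_kronecker_cupPowTwo_ne_zero h₁ h₂ hn μ hX hσt hσ0 hnorm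
    (kroneckerPairing_cupPowTwo_fundamentalClass_ne_zero μ hX ha)

end Literature.AlgebraicGeometry.Hyperkaehler

end
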